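import Summits.ValiantsHypothesis.ValiantsHypothesis.Theses.SOSTau

/-!
# Route SOSTau — `Assembly` (stmt-ValiantsHypothesis-18756)

`SOSTau → HutchinsonMagnification → ValiantsHypothesis` is the route's deciding theorem `closes`;
candidate proof on file (grounder), landed under Theorems (prover-only). Honest framing: bookkeeping only.
-/

set_option linter.dupNamespace false

namespace Summit.ValiantsHypothesis.ValiantsHypothesis.Theorems.SOSTau

open Summit.ValiantsHypothesis.ValiantsHypothesis.Theses.SOSTau

/-- **Item `Assembly` (stmt-ValiantsHypothesis-18756), PROVED** by `closes`. [folklore] -/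
theorem assembly_proof : Assembly :=
  fun h₁ h₂ => closes h₁ h₂

end Summit.ValiantsHypothesis.ValiantsHypothesis.Theorems.SOSTau
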